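import Summits.BirchSwinnertonDyer.BirchSwinnertonDyer.Theorems.GenusKolyvaginAtTwoPowDvdShaCardAtTwoRTRelaxedSelmerGenusBudgetHeegner
import Summits.BirchSwinnertonDyer.BirchSwinnertonDyer.Theorems.GenusKolyvaginAtTwoGenusPrimitiveSupplyAtTwoHeegnerTwinTamagawaOdd
import Literature.NumberTheory.EllipticCurves.QuadraticTwistTamagawaI0starExactProofs
import Literature.NumberTheory.EllipticCurves.PastenValuationProductThm115Proofs
import Literature.NumberTheory.EllipticCurves.HeegnerHypothesisKroneckerProofs
import Literature.NumberTheory.QuadraticFields.FundamentalDiscriminant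
import Literature.NumberTheory.QuadraticFields.QuadraticDedekindZeta
import HarnessLib

/-!
# Route `GenusKolyvaginAtTwo`, LINE 18 / LINE 19 (L_T stmt-BirchSwinnertonDyer-23242, L⁺_T stmt-23379): the genus budget in the
# CURRENCY OF THE LEVER 3a‴ — `ord₂ C(Wd) = ord₂ C(W) + Σ_{q ∣ d_K} ord₂ #Ẽ(𝔽_q)[2]` for the Heegner twin `Wd ≅ W^{(d_K)}`, hence
# `∏_{q ∣ d_K} (#{roots of ψ mod q} + 1) = 2^{ord₂ C(Wd)}` when `C(W)` is odd, and `[Sel^rel : Sel^(n)(W/ℚ)] ≤ 2^{ord₂ C(Wd)}`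

Seat `bsd-line-gk2-p3` g17 (cell `bsd-f1-sign2`), `--supports stmt-BirchSwinnertonDyer-23242` (helper; closes nothing).
THEOREMS ONLY (no definition, no named fact, no `sorry`); BSD is not proved by any of this.

The v4.2 lever `stub_twinLadderGenus` of LINE 18 concludes `2M₀ ≤ ord₂ g + ord₂ g′ + ord₂ C(Wd) − 1`, the genus budget being
read in the Tamagawa product of a globally minimal model `Wd` of the twist `W^{(d_K)}` (`c_q(Wd) = #Ẽ(𝔽_q)[2]` at `q ∣ d_K`, type
`I₀*`, Boxer–Diao / Kramer Prop. 3).  This file identifies that reading with the one of this lineage's budget theorem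
(`relIndex_selmerGroup_relaxed_le_prod_ncard_roots_add_one_of_heegner`: `∏_{q ∣ d_K} (#{roots of ψ mod q} + 1)`):

* §1 `one_add_card_roots_eq_two_pow` — at a good odd `q`, `1 + #{x̄ : ψ(x̄) = 0} = 2^{ord₂(1 + #…)}` (`= #Ẽ(𝔽_q)[2] ∈ {1,2,4}`;
  Kramer 1981 p. 125 via the tree's `TwistIstar.exists_card_roots_add_one_eq_two_pow`).
* §2 `padicValNat_two_tamagawaProduct_twin_eq` — **`ord₂ C(Wd) = ord₂ C(W) + Σ_{q ∣ d_K} ord₂ (1 + #{roots of ψ mod q})`** for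
  `W/ℚ` globally minimal elliptic, `K` imaginary quadratic with odd `d_K` and the Heegner hypothesis for `N_W`, and ANY model
  `Wd = Cd • W^{(d_K)}`: place by place (`tamagawaProduct_eq_prod`), `c_ℓ(Wd) = c_ℓ(W)` at `ℓ ∣ N_W` (split in `K`, gk2-p5's
  `GenusKolyTwin.localTamagawaNumber_twin_eq_of_dvd_conductorNorm`), `c_ℓ(Wd) = c_ℓ(W) = 1` off `N_W d_K`
  (`GenusKolyTwin.localTamagawaNumber_twist_eq_one_of_not_dvd`), and `c_q(W) = 1`, `c_q(Wd) = 1 + #{roots}` at `q ∣ d_K`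
  (`TwistIstar.localTamagawaNumber_padic_twist_eq_one_add_card`; `q` odd, `q ∥ d_K`, `q ∤ N_W` by the Heegner hypothesis) —
  the template of fkl-p2's `doorTwistTamagawaAtTwo` with the door-admissibility replaced by the Heegner data.
* §3 `prod_ncard_roots_add_one_eq_two_pow_padicValNat_tamagawaProduct_twin` — with `C(W)` odd:
  **`∏_{q ∣ d_K} (#{roots of ψ mod q} + 1) = 2^{ord₂ C(Wd)}`**; and the budget in the lever's currency,
  `relIndex_selmerGroup_relaxed_le_two_pow_padicValNat_tamagawaProduct_twin`: **`[Sel^rel : Sel^(n)(W/ℚ)] ≤ 2^{ord₂ C(Wd)}`**.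

References: [Kramer1981] §2 Prop. 3 (p. 125), Thm. 1; [BoxerDiao2010] proof of Prop. 4.1; [SilvermanATAEC1994] IV.9.4 Step 6;
[GrossLMS1991] §1; [MazurRubin2010] Lemma 2.2 (i).
-/

set_option autoImplicit false
-- the Theorems namespace of this sub repeats the summit name by design (D-0017 nested layout)
set_option linter.dupNamespace false

noncomputable section

open scoped Classical

namespace Summit.BirchSwinnertonDyer.BirchSwinnertonDyer.Theorems.GenusExact.PlusDescent

open WeierstrassCurve NumberField IsDedekindDomain Rat.HeightOneSpectrum Literature.NumberTheory.EllipticCurves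
  Literature.Barriers.BirchSwinnertonDyer Polynomial

/-- `ord_p` of a finite product of non-zero naturals is the sum of the `ord_p` (the tree has this as a private lemma of
`…OneDoorTamagawa` and in `AxKatzDigits`; restated privately to keep the imports light). [folklore] -/
private theorem padicValNat_finset_prod' (p : ℕ) [Fact p.Prime] {ι : Type*} (s : Finset ι)
    (f : ι → ℕ) (hf : ∀ i ∈ s, f i ≠ 0) :
    padicValNat p (∏ i ∈ s, f i) = ∑ i ∈ s, padicValNat p (f i) := by
  induction s using Finset.induction_on with
  | empty => simp
  | insert a s ha ih =>
    rw [Finset.prod_insert ha, Finset.sum_insert ha,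
      padicValNat.mul (hf a (Finset.mem_insert_self a s)) (Finset.prod_ne_zero_iff.mpr fun i hi ↦
        hf i (Finset.mem_insert_of_mem hi)),
      ih fun i hi ↦ hf i (Finset.mem_insert_of_mem hi)]

/-! ## §1 `1 + #{roots of ψ mod q}` is a power of `2` -/

section Roots

variable (W : WeierstrassCurve ℚ) [W.IsGloballyMinimal] {q : ℕ} [hq : Fact q.Prime]

/-- **`1 + #{x̄ ∈ 𝔽_q : ψ(x̄) = 0} = 2^{ord₂(1 + #…)}`** at an odd prime `q ∤ Δ_min(W)`: the reduction `Mq` of the integral minimal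
model is an elliptic curve over `𝔽_q`, `ψ̄` is its (separable) `2`-division cubic, and `1 + #roots(ψ̄) = #Mq(𝔽_q)[2] = 2ⁱ`
(Kramer 1981, p. 125; tree `TwistIstar.exists_card_roots_add_one_eq_two_pow`). [cite: Kramer1981, §2 proof of Prop. 3 (p. 125)] -/
theorem one_add_card_roots_eq_two_pow (hq2 : q ≠ 2) (hqΔ : ¬ (q : ℤ) ∣ minimalDiscriminantInt W) :
    1 + (Finset.univ.filter fun x : ZMod q =>
        4 * x ^ 3 + ((integralModelInt W).b₂ : ZMod q) * x ^ 2 +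
          2 * ((integralModelInt W).b₄ : ZMod q) * x + ((integralModelInt W).b₆ : ZMod q) = 0).card =
      2 ^ padicValNat 2 (1 + (Finset.univ.filter fun x : ZMod q =>
        4 * x ^ 3 + ((integralModelInt W).b₂ : ZMod q) * x ^ 2 +
          2 * ((integralModelInt W).b₄ : ZMod q) * x + ((integralModelInt W).b₆ : ZMod q) = 0).card) := by
  have hqP : q.Prime := hq.out
  haveI : NeZero q := ⟨hqP.ne_zero⟩
  set M := integralModelInt W with hM
  set Mq : WeierstrassCurve (ZMod q) := M.map (Int.castRingHom (ZMod q)) with hMq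
  have hΔq : Mq.Δ = (M.Δ : ZMod q) := by rw [hMq, map_Δ, eq_intCast]
  have hΔq0' : Mq.Δ ≠ 0 := by
    rw [hΔq, Ne, ZMod.intCast_zmod_eq_zero_iff_dvd]
    exact hqΔ
  haveI : Mq.IsElliptic := (WeierstrassCurve.isElliptic_iff _).mpr (Ne.isUnit hΔq0')
  have h2 : (2 : ZMod q) ≠ 0 := by
    have : ((2 : ℕ) : ZMod q) ≠ 0 := by
      rw [Ne, ZMod.natCast_eq_zero_iff]
      intro h
      exact hq2 ((Nat.prime_dvd_prime_iff_eq hqP Nat.prime_two).mp h)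
    exact_mod_cast this
  have h4 : (4 : ZMod q) ≠ 0 := by
    have : (4 : ZMod q) = 2 * 2 := by norm_num
    rw [this]; exact mul_ne_zero h2 h2
  have h16 : (16 : ZMod q) ≠ 0 := by
    have : (16 : ZMod q) = 2 ^ 4 := by norm_num
    rw [this]; exact pow_ne_zero 4 h2
  have ha : Mq.twoTorsionPolynomial.a ≠ 0 := h4
  have hψ0 : Mq.twoTorsionPolynomial.toPoly ≠ 0 := Cubic.ne_zero_of_a_ne_zero ha
  have hψ : ∀ x : ZMod q, Mq.twoTorsionPolynomial.toPoly.IsRoot x ↔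
      4 * x ^ 3 + (M.b₂ : ZMod q) * x ^ 2 + 2 * (M.b₄ : ZMod q) * x + (M.b₆ : ZMod q) = 0 := by
    intro x
    simp only [WeierstrassCurve.twoTorsionPolynomial, Cubic.toPoly, hMq, map_b₂, map_b₄, map_b₆,
      eq_intCast, Polynomial.IsRoot.def, eval_add, eval_mul, eval_C, eval_pow, eval_X]
  have hS : Mq.twoTorsionPolynomial.toPoly.roots.toFinset = Finset.univ.filter fun x : ZMod q =>
      4 * x ^ 3 + (M.b₂ : ZMod q) * x ^ 2 + 2 * (M.b₄ : ZMod q) * x + (M.b₆ : ZMod q) = 0 := by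
    ext x
    rw [Multiset.mem_toFinset, Polynomial.mem_roots hψ0, hψ, Finset.mem_filter]
    simp
  have hdisc : Mq.twoTorsionPolynomial.discr ≠ 0 := by
    rw [WeierstrassCurve.twoTorsionPolynomial_discr]; exact mul_ne_zero h16 hΔq0'
  have hsep : Mq.twoTorsionPolynomial.toPoly.Separable := by
    have hspl : (Mq.twoTorsionPolynomial.toPoly.map (algebraMap (ZMod q) (AlgebraicClosure (ZMod q)))).Splits :=
      IsAlgClosed.splits _
    have hnd : (Cubic.map (algebraMap (ZMod q) (AlgebraicClosure (ZMod q))) Mq.twoTorsionPolynomial).roots.Nodup :=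
      (Cubic.discr_ne_zero_iff_roots_nodup ha hspl).mp hdisc
    rw [Cubic.map_roots] at hnd
    exact (separable_map (algebraMap (ZMod q) (AlgebraicClosure (ZMod q)))).mp
      ((nodup_roots_iff_of_splits (Polynomial.map_ne_zero hψ0) hspl).mp hnd)
  have hcard : (Finset.univ.filter fun x : ZMod q =>
      4 * x ^ 3 + (M.b₂ : ZMod q) * x ^ 2 + 2 * (M.b₄ : ZMod q) * x + (M.b₆ : ZMod q) = 0).card =
        Multiset.card Mq.twoTorsionPolynomial.toPoly.roots := by
    rw [← hS, Multiset.toFinset_card_of_nodup (Polynomial.nodup_roots hsep)]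
  obtain ⟨i, hi, -, -⟩ := TwistIstar.exists_card_roots_add_one_eq_two_pow Mq h2
  rw [hcard, add_comm, hi, padicValNat.prime_pow]

end Roots

/-! ## §2 `ord₂ C(Wd) = ord₂ C(W) + Σ_{q ∣ d_K} ord₂ (1 + #{roots of ψ mod q})` for the Heegner twin -/

section Twin

variable (W : WeierstrassCurve ℚ) [W.IsElliptic] [W.IsGloballyMinimal]
  {K : Type} [Field K] [NumberField K]

/-- **The `2`-adic valuation of the Tamagawa product of a Heegner twist.**  `W/ℚ` globally minimal elliptic, `K` imaginary
quadratic with odd `d_K` satisfying the Heegner hypothesis for `N_W`, `Wd = Cd • W^{(d_K)}` any (elliptic) model of the twist: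
`ord₂ C(Wd) = ord₂ C(W) + Σ_{q ∣ d_K} ord₂ (1 + #{x̄ ∈ 𝔽_q : 4x̄³ + b₂x̄² + 2b₄x̄ + b₆ = 0})`.  Place by place on the bad
places of `W`, `Wd` and the primes of `d_K` (`tamagawaProduct_eq_prod`): `c_ℓ(Wd) = c_ℓ(W)` at `ℓ ∣ N_W` (split in `K`),
`= 1` off `N_W d_K`, and at `q ∣ d_K` (`q` odd, `q ∥ d_K`, good for `W`): `c_q(W) = 1`, `c_q(Wd) = 1 + #{roots}` (type `I₀*`,
Boxer–Diao; `TwistIstar.localTamagawaNumber_padic_twist_eq_one_add_card`). [cite: Kramer1981, §2 Prop. 3]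
[cite: BoxerDiao2010, proof of Prop. 4.1 (p. 1977)] [cite: SilvermanATAEC1994, IV.9.4 Step 6 (PDF p. 345)] -/
theorem padicValNat_two_tamagawaProduct_twin_eq (hK : IsImaginaryQuadratic K) (hodd : Odd (NumberField.discr K))
    (hH : SatisfiesHeegnerHypothesis (W.conductorNorm ℤ) K) {Wd : WeierstrassCurve ℚ} [Wd.IsElliptic]
    (Cd : VariableChange ℚ) (hWd : Cd • W.quadraticTwist (NumberField.discr K : ℚ) = Wd) :
    padicValNat 2 Wd.tamagawaProduct = padicValNat 2 W.tamagawaProduct +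
      ∑ q ∈ (NumberField.discr K).natAbs.primeFactors, padicValNat 2
        ({x : ZMod q | 4 * x ^ 3 + ((integralModelInt W).b₂ : ZMod q) * x ^ 2 +
          2 * ((integralModelInt W).b₄ : ZMod q) * x + ((integralModelInt W).b₆ : ZMod q) = 0}.ncard + 1) := by
  have hfact2 : Fact (Nat.Prime 2) := ⟨Nat.prime_two⟩
  have hd4 : NumberField.discr K % 4 = 1 := Literature.NumberTheory.QuadraticFields.Quadratic.discr_emod_four_eq_one hK.1 hodd
  have hd0 : NumberField.discr K ≠ 0 := NumberField.discr_ne_zero K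
  -- at a prime `q ∣ d_K`: `q` odd, `q ∤ N`, `q ∤ Δ_min`, `q ∥ d_K`
  have hdK : ∀ (q : ℕ) [Fact q.Prime], (q : ℤ) ∣ NumberField.discr K →
      q ≠ 2 ∧ ¬ q ∣ W.conductorNorm ℤ ∧ ¬ (q : ℤ) ∣ minimalDiscriminantInt W ∧
        ∃ d₁ : ℤ, NumberField.discr K = q * d₁ ∧ ¬ (q : ℤ) ∣ d₁ := by
    intro q hq hqd
    have hq2 : q ≠ 2 := by
      rintro rfl
      exact (Int.not_even_iff_odd.mpr hodd) (even_iff_two_dvd.mpr (by exact_mod_cast hqd))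
    have hqN : ¬ q ∣ W.conductorNorm ℤ := fun hqN =>
      Literature.SatisfiesHeegnerHypothesis.not_dvd_discr hK.1 hH hq.out hqN hqd
    refine ⟨hq2, hqN, fun hqΔ => hqN (GenusKolyTwin.dvd_conductorNorm_of_dvd_minimalDiscriminantInt W hq.out hqΔ), ?_⟩
    obtain ⟨d₁, hd⟩ := hqd
    refine ⟨d₁, hd, ?_⟩
    rintro ⟨e, rfl⟩
    exact Literature.NumberTheory.QuadraticFields.Quadratic.not_sq_dvd_discr_of_prime_ne_two hK.1 hq.out hq2
      ⟨e, by rw [hd]; ring⟩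
  -- the finite set of places: bad places of `W`, of `Wd`, and the primes of `d_K`
  have hfW : (W.badPlaces ℤ).Finite := W.finite_badPlaces_holds ℤ
  have hfWd : (Wd.badPlaces ℤ).Finite := Wd.finite_badPlaces_holds ℤ
  set P : Finset ℕ := (NumberField.discr K).natAbs.primeFactors with hP
  have hPmem : ∀ q, q ∈ P ↔ q.Prime ∧ (q : ℤ) ∣ NumberField.discr K := by
    intro q
    rw [hP, Nat.mem_primeFactors, Int.natCast_dvd]
    exact ⟨fun h => ⟨h.1, h.2.1⟩, fun h => ⟨h.1, h.2, Int.natAbs_ne_zero.mpr hd0⟩⟩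
  set D : Finset (HeightOneSpectrum ℤ) :=
    P.attach.image fun q => (primesEquiv (R := ℤ)).symm ⟨q.1, ((hPmem q.1).mp q.2).1⟩ with hD
  set s : Finset (HeightOneSpectrum ℤ) := hfW.toFinset ∪ hfWd.toFinset ∪ D with hs
  have hsW : ∀ v, ¬ W.HasGoodReductionAt v → v ∈ s := fun v hv ↦
    Finset.mem_union_left _ (Finset.mem_union_left _
      (by rw [Set.Finite.mem_toFinset, mem_badPlaces_iff]; exact hv))
  have hsWd : ∀ v, ¬ Wd.HasGoodReductionAt v → v ∈ s := fun v hv ↦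
    Finset.mem_union_left _ (Finset.mem_union_right _
      (by rw [Set.Finite.mem_toFinset, mem_badPlaces_iff]; exact hv))
  have hsD : ∀ q (hq : q ∈ P), (primesEquiv (R := ℤ)).symm ⟨q, ((hPmem q).mp hq).1⟩ ∈ s := fun q hq ↦
    Finset.mem_union_right _ (Finset.mem_image.mpr ⟨⟨q, hq⟩, Finset.mem_attach _ _, rfl⟩)
  -- local Tamagawa numbers as functions of the place
  set cW : HeightOneSpectrum ℤ → ℕ := fun v =>
    haveI := Fact.mk (primesEquiv v).2
    (W.baseChange ℚ_[primesEquiv v]).localTamagawaNumber ℤ_[primesEquiv v] with hcW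
  set cWd : HeightOneSpectrum ℤ → ℕ := fun v =>
    haveI := Fact.mk (primesEquiv v).2
    (Wd.baseChange ℚ_[primesEquiv v]).localTamagawaNumber ℤ_[primesEquiv v] with hcWd
  have hcW0 : ∀ v ∈ s, cW v ≠ 0 := fun v _ ↦ by
    haveI := Fact.mk (primesEquiv v).2
    haveI : (W.baseChange ℚ_[primesEquiv v]).IsElliptic :=
      inferInstanceAs (W.map (algebraMap ℚ ℚ_[primesEquiv v])).IsElliptic
    exact localTamagawaNumber_padic_ne_zero_holds (primesEquiv v) _
  have hcWd0 : ∀ v ∈ s, cWd v ≠ 0 := fun v _ ↦ by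
    haveI := Fact.mk (primesEquiv v).2
    haveI : (Wd.baseChange ℚ_[primesEquiv v]).IsElliptic :=
      inferInstanceAs (Wd.map (algebraMap ℚ ℚ_[primesEquiv v])).IsElliptic
    exact localTamagawaNumber_padic_ne_zero_holds (primesEquiv v) _
  have hprodW : W.tamagawaProduct = ∏ v ∈ s, cW v := tamagawaProduct_eq_prod W s hsW
  have hprodWd : Wd.tamagawaProduct = ∏ v ∈ s, cWd v := tamagawaProduct_eq_prod Wd s hsWd
  rw [hprodW, hprodWd, padicValNat_finset_prod' 2 s cW hcW0, padicValNat_finset_prod' 2 s cWd hcWd0]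
  -- the summand at the primes of `d_K`
  set g : ℕ → ℕ := fun q => padicValNat 2
        ({x : ZMod q | 4 * x ^ 3 + ((integralModelInt W).b₂ : ZMod q) * x ^ 2 +
          2 * ((integralModelInt W).b₄ : ZMod q) * x + ((integralModelInt W).b₆ : ZMod q) = 0}.ncard + 1) with hg
  -- place by place
  have hloc : ∀ v ∈ s, padicValNat 2 (cWd v) =
      padicValNat 2 (cW v) + if ((primesEquiv v : ℕ) : ℤ) ∣ NumberField.discr K then g (primesEquiv v) else 0 := by
    intro v _
    haveI := Fact.mk (primesEquiv v).2
    set ℓ : ℕ := (primesEquiv v : ℕ) with hℓ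
    have hℓP : ℓ.Prime := (primesEquiv v).2
    by_cases hℓd : (ℓ : ℤ) ∣ NumberField.discr K
    · -- a prime of `d_K`: `c_ℓ(W) = 1`, `c_ℓ(Wd) = 1 + #roots`
      rw [if_pos hℓd]
      obtain ⟨hℓ2, hℓN, hℓΔ, d₁, hd, hd₁⟩ := hdK ℓ hℓd
      have hgood : W.HasGoodReductionAtPrime ℓ := by
        by_contra h; exact hℓN ((W.dvd_conductorNorm_iff_not_hasGoodReductionAtPrime ℓ).mpr h)
      have h1 : cW v = 1 := by
        haveI : (W.baseChange ℚ_[ℓ]).IsElliptic := inferInstanceAs (W.map (algebraMap ℚ ℚ_[ℓ])).IsElliptic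
        haveI : ((W.baseChange ℚ_[ℓ]).minimal ℤ_[ℓ]).HasGoodReduction ℤ_[ℓ] := hgood
        exact localTamagawaNumber_eq_one_of_hasGoodReduction_holds ℤ_[ℓ] _
      rw [h1, padicValNat_one_right, zero_add]
      have hc : cWd v = 1 + (Finset.univ.filter fun x : ZMod ℓ =>
          4 * x ^ 3 + ((integralModelInt W).b₂ : ZMod ℓ) * x ^ 2 +
            2 * ((integralModelInt W).b₄ : ZMod ℓ) * x + ((integralModelInt W).b₆ : ZMod ℓ) = 0).card :=
        TwistIstar.localTamagawaNumber_padic_twist_eq_one_add_card W ℓ hℓ2 hℓΔ hd hd₁ Cd hWd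
      rw [hc, hg]
      dsimp only
      rw [Set.ncard_eq_toFinset_card', Set.toFinset_setOf, add_comm]
    · rw [if_neg hℓd, add_zero]
      by_cases hℓN : ℓ ∣ W.conductorNorm ℤ
      · exact congrArg _ (GenusKolyTwin.localTamagawaNumber_twin_eq_of_dvd_conductorNorm W hK hH Cd hWd ℓ hℓN)
      · have hgood : W.HasGoodReductionAtPrime ℓ := by
          by_contra h; exact hℓN ((W.dvd_conductorNorm_iff_not_hasGoodReductionAtPrime ℓ).mpr h)
        have h1 : cW v = 1 := by
          haveI : (W.baseChange ℚ_[ℓ]).IsElliptic := inferInstanceAs (W.map (algebraMap ℚ ℚ_[ℓ])).IsElliptic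
          haveI : ((W.baseChange ℚ_[ℓ]).minimal ℤ_[ℓ]).HasGoodReduction ℤ_[ℓ] := hgood
          exact localTamagawaNumber_eq_one_of_hasGoodReduction_holds ℤ_[ℓ] _
        have h1d : cWd v = 1 := GenusKolyTwin.localTamagawaNumber_twist_eq_one_of_not_dvd W hd4 Cd hWd ℓ hgood hℓd
        rw [h1, h1d]
  rw [Finset.sum_congr rfl hloc, Finset.sum_add_distrib, ← Finset.sum_filter]
  -- the `d_K`-part of the sum is indexed by the prime factors of `|d_K|`
  have hfilter : ∑ v ∈ s.filter (fun v => ((primesEquiv v : ℕ) : ℤ) ∣ NumberField.discr K), g (primesEquiv v) =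
      ∑ q ∈ P, g q := by
    refine Finset.sum_nbij' (fun v => (primesEquiv v : ℕ))
      (fun q => if h : q.Prime then (primesEquiv (R := ℤ)).symm ⟨q, h⟩
        else (primesEquiv (R := ℤ)).symm ⟨2, Nat.prime_two⟩)
      (fun v hv => ?_) (fun q hq => ?_) (fun v hv => ?_) (fun q hq => ?_) (fun v _ => rfl)
    · rw [Finset.mem_filter] at hv
      rw [hPmem]
      exact ⟨(primesEquiv v).2, hv.2⟩
    · have hq' := (hPmem q).mp hq
      rw [Finset.mem_filter, dif_pos hq'.1, Equiv.apply_symm_apply]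
      exact ⟨hsD q hq, hq'.2⟩
    · simp only [dif_pos (primesEquiv v).2, Subtype.coe_eta, Equiv.symm_apply_apply]
    · simp only [dif_pos ((hPmem q).mp hq).1, Equiv.apply_symm_apply, Subtype.coe_mk]
  rw [hfilter]

/-- **`∏_{q ∣ d_K} (#{roots of ψ mod q} + 1) = 2^{ord₂ C(Wd)}` when `C(W)` is odd** (same data, `Wd` any model of the Heegner
twist): the product of the `#Ẽ(𝔽_q)[2] = 2^{i_q}` over the primes of `d_K` is the full `2`-part of the Tamagawa product of the
twin (`padicValNat_two_tamagawaProduct_twin_eq`, `one_add_card_roots_eq_two_pow`). [cite: Kramer1981, §2 Prop. 3 and Thm. 1]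
[cite: BoxerDiao2010, proof of Prop. 4.1 (p. 1977)] -/
theorem prod_ncard_roots_add_one_eq_two_pow_padicValNat_tamagawaProduct_twin (hK : IsImaginaryQuadratic K)
    (hodd : Odd (NumberField.discr K)) (hH : SatisfiesHeegnerHypothesis (W.conductorNorm ℤ) K) (hT : Odd W.tamagawaProduct)
    {Wd : WeierstrassCurve ℚ} [Wd.IsElliptic] (Cd : VariableChange ℚ) (hWd : Cd • W.quadraticTwist (NumberField.discr K : ℚ) = Wd) :
    ∏ q ∈ (NumberField.discr K).natAbs.primeFactors,
        ({x : ZMod q | 4 * x ^ 3 + ((integralModelInt W).b₂ : ZMod q) * x ^ 2 +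
          2 * ((integralModelInt W).b₄ : ZMod q) * x + ((integralModelInt W).b₆ : ZMod q) = 0}.ncard + 1) =
      2 ^ padicValNat 2 Wd.tamagawaProduct := by
  have hW0 : padicValNat 2 W.tamagawaProduct = 0 :=
    padicValNat.eq_zero_of_not_dvd fun h ↦ (Nat.not_even_iff_odd.mpr hT) (even_iff_two_dvd.mpr h)
  rw [padicValNat_two_tamagawaProduct_twin_eq W hK hodd hH Cd hWd, hW0, zero_add, ← Finset.prod_pow_eq_pow_sum]
  refine Finset.prod_congr rfl fun q hq ↦ ?_
  obtain ⟨hqP, hqdvd, -⟩ := Nat.mem_primeFactors.mp hq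
  have hqd : (q : ℤ) ∣ NumberField.discr K := Int.natCast_dvd.mpr hqdvd
  haveI := Fact.mk hqP
  have hq2 : q ≠ 2 := by
    rintro rfl
    exact (Int.not_even_iff_odd.mpr hodd) (even_iff_two_dvd.mpr (by exact_mod_cast hqd))
  have hqΔ : ¬ (q : ℤ) ∣ minimalDiscriminantInt W :=
    not_dvd_minimalDiscriminantInt_of_dvd_discr_of_heegner W K hK.1 hH hqP hq2 hqd
  rw [Set.ncard_eq_toFinset_card', Set.toFinset_setOf, add_comm]
  exact one_add_card_roots_eq_two_pow W hq2 hqΔ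

/-- **THE GENUS BUDGET IN THE CURRENCY OF THE LEVER 3a‴: `[Sel^rel : Sel^(n)(W/ℚ)] ≤ 2^{ord₂ C(Wd)}`.**  For `W/ℚ` globally minimal
elliptic with `C(W)` odd, `K` imaginary quadratic with odd `d_K` and the Heegner hypothesis for `N_W`, `Wd = Cd • W^{(d_K)}` any
model of the twin, and every level `n`: the `d_K`-relaxed Selmer group `res⁻¹(Sel^(n)(W_K/K)) ⊓ ⨅_∞` contains `Sel^(n)(W/ℚ)` with
index at most `2^{ord₂ C(Wd)}` — the exponent `ord₂ C(Wd)` of `stub_twinLadderGenus` IS the genus budget `Σ_{q ∣ d_K} i_q`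
(`relIndex_selmerGroup_relaxed_le_prod_ncard_roots_add_one_of_heegner`,
`prod_ncard_roots_add_one_eq_two_pow_padicValNat_tamagawaProduct_twin`). [cite: Kramer1981, §2 Prop. 3 and Thm. 1]
[cite: MazurRubin2010, Lemma 2.2 (i) and Prop. 3.3] -/
theorem relIndex_selmerGroup_relaxed_le_two_pow_padicValNat_tamagawaProduct_twin (hK : IsImaginaryQuadratic K)
    (hodd : Odd (NumberField.discr K)) (hH : SatisfiesHeegnerHypothesis (W.conductorNorm ℤ) K) (hT : Odd W.tamagawaProduct)
    {Wd : WeierstrassCurve ℚ} [Wd.IsElliptic] (Cd : VariableChange ℚ) (hWd : Cd • W.quadraticTwist (NumberField.discr K : ℚ) = Wd)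
    (n : ℤ) :
    (selmerGroup W n).relIndex ((selmerGroup (W.baseChange K) n).comap (resTorsion W K n) ⊓
        ⨅ w : InfinitePlace ℚ, selmerLocalKer W w.Completion n) ≤ 2 ^ padicValNat 2 Wd.tamagawaProduct := by
  rw [← prod_ncard_roots_add_one_eq_two_pow_padicValNat_tamagawaProduct_twin W hK hodd hH hT Cd hWd]
  exact relIndex_selmerGroup_relaxed_le_prod_ncard_roots_add_one_of_heegner W K hK hodd hH n

end Twin

end Summit.BirchSwinnertonDyer.BirchSwinnertonDyer.Theorems.GenusExact.PlusDescent

end
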